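import Mathlib
import HarnessLib
import Literature.Barriers.CriticalPhenomena.PositionSpaceRGNonGibbsianChessboard
import Literature.MathematicalPhysics.QuantumFieldTheory.ConstructiveQFTWave0Proofs

/-!
# Crux `FemtoCurvatureTwoPoint` (stmt-QuantumFields-9363, route `LangevinControlUV`):
# stub CHESS-of-RPCS — the chessboard estimate for the `01`-plaquette field on dyadic tori

Helper for the line `generic-step-gamma-encoding` (`--supports stmt-QuantumFields-9363`), closing the
registered stub `stub_chessboard_of_RPCS` verbatim: on the torus `(ℤ/Lℤ)⁴` with `L = 2^(n+1)`, for a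
continuous unitary matrix representation `ρ` of a compact group `G`, `β ≥ 0` and a bounded measurable
`f ≥ 0`, the reflection Cauchy–Schwarz inequalities (hypothesis RPCS, the statement of the neighbouring
stub `stub_plaquetteProductRPCS`)

  `ψ(S)² ≤ ψ(symP i k S) ψ(symM i k S)`,  `ψ(S) = E_β[∏_{x ∈ S} f(N − Re tr ρ(U_{(x;01)}))]`,

for all block reflections of `Literature.Barriers.CriticalPhenomena.NonGibbs` (cells = base points)
imply the chessboard estimate for one cell (Fröhlich–Israel–Lieb–Simon 1978; Friedli–Velenik 2017,
Theorem 10.11):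

  `E_β[f(P_0)] ≤ (E_β[∏_x f(P_x)])^{1/L⁴}`.

Proof (iterated doubling; no maximiser and no positivity of `ψ(univ)` is needed, unlike the tree's
`chessboard_pow_le`): `ψ ≥ 0` (`f ≥ 0`) and `ψ(∅) = μ(univ) ≤ 1` (the Wilson state has total mass
`Z⁻¹ Z ≤ 1`). A run `R = axisRun t₀ i j` of `2^j` blocks, `2^(j+1) ≤ L`, lies in the negative half of the
reflection through the block boundary `t₀ᵢ + 2^j`, so `symP R = ∅` and `symM R = R ∪ θR` is the run of
`2^(j+1)` blocks (`symM_axisRun`); RPCS gives `ψ(R)² ≤ ψ(∅) ψ(R ∪ θR) ≤ ψ(R ∪ θR)`. After `n+1`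
doublings in direction `0`, then `1`, `2`, `3` (tree `axisRun_zero`, `axisRun_of_le`, `boxRun_zero`,
`boxRun_eq_univ`): `ψ({t₀})^(L⁴) ≤ ψ(univ)`, and `L⁴`-th roots conclude.

The combinatorial part is written for a general dimension `d` and `N = 2^(n+1)` blocks
(`ChessboardOfRPCS.singleton_pow_le_univ`, `ChessboardOfRPCS.singleton_le_univ_rpow`).

Not here: RPCS itself (reflection positivity of Wilson's measure; neighbouring stub), the general
chessboard estimate `ψ(S) ≤ ψ(univ)^{#S/N^d}` for arbitrary `S` (tree `chessboard_le_rpow`, which needs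
`0 < ψ univ`).

## References

* J. Fröhlich, R. Israel, E. H. Lieb, B. Simon, Comm. Math. Phys. 62 (1978) 1–34 [FrohlichIsraelLiebSimon1978].
* S. Friedli, Y. Velenik, *Statistical Mechanics of Lattice Systems*, CUP 2017, Theorem 10.11
  [FriedliVelenik2017].
-/

noncomputable section

open scoped BigOperators Matrix ENNReal
open MeasureTheory Filter Topology ProbabilityTheory

namespace Summit.QuantumFields.YangMills.Theorems.FemtoCurvatureTwoPoint.ChessboardOfRPCS

open Finset
open Literature.Barriers.CriticalPhenomena.NonGibbs

section Doubling

variable {d N : ℕ} [NeZero N]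

/-- A run of `2^j` blocks in direction `i` (`2^(j+1) ≤ N`) lies in the negative half of the reflection
through the block boundary `t₀ᵢ + 2^j`, so its positive symmetrisation is empty.
[cite: FriedliVelenik2017, Theorem 10.11 (proof)] -/
theorem symP_axisRun_eq_empty {j : ℕ} (hj : 2 ^ (j + 1) ≤ N) (t₀ : BlockIdx d N) (i : Fin d) :
    symP i (t₀ i + ((2 ^ j : ℕ) : ZMod N)) (axisRun t₀ i j) = ∅ := by
  have hj' : 2 ^ j ≤ N / 2 := by rw [pow_succ] at hj; omega
  have hint : axisRun t₀ i j ∩ halfPlus N i (t₀ i + ((2 ^ j : ℕ) : ZMod N)) = ∅ := by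
    rw [← Finset.disjoint_iff_inter_eq_empty]
    exact (disjoint_halfPlus_halfMinus i _).symm.mono_left (axisRun_subset_halfMinus hj' t₀ i)
  rw [symP, hint, image_empty, union_empty]

/-- **Doubling a run**: the negative symmetrisation of the run of `2^j` blocks through the block
boundary `t₀ᵢ + 2^j` is exactly the run of `2^(j+1)` blocks (`2^(j+1) ≤ N`).
[cite: FriedliVelenik2017, Theorem 10.11 (proof)] -/
theorem symM_axisRun {j : ℕ} (hj : 2 ^ (j + 1) ≤ N) (t₀ : BlockIdx d N) (i : Fin d) :
    symM i (t₀ i + ((2 ^ j : ℕ) : ZMod N)) (axisRun t₀ i j) = axisRun t₀ i (j + 1) := by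
  set k : ZMod N := t₀ i + ((2 ^ j : ℕ) : ZMod N) with hk
  have hj' : 2 ^ j ≤ N / 2 := by rw [pow_succ] at hj; omega
  have hsub : axisRun t₀ i j ⊆ halfMinus N i k := axisRun_subset_halfMinus hj' t₀ i
  have hinter : axisRun t₀ i j ∩ halfMinus N i k = axisRun t₀ i j := inter_eq_left.2 hsub
  ext c
  rw [symM, hinter, mem_union, mem_image]
  constructor
  · rintro (hc | ⟨c', hc', rfl⟩)
    · rw [mem_axisRun] at hc ⊢
      exact ⟨hc.1, hc.2.trans_le (Nat.pow_le_pow_right two_pos (Nat.le_succ j))⟩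
    · rw [mem_axisRun] at hc' ⊢
      obtain ⟨h1, h2⟩ := hc'
      refine ⟨fun i' hi' => ?_, ?_⟩
      · rw [cellReflect_apply_of_ne _ _ _ (fun h => by rw [h] at hi'; exact lt_irrefl _ hi'), h1 i' hi']
      · have hval : cellReflect i k c' i - t₀ i = ((2 ^ (j + 1) - 1 : ℕ) : ZMod N) - (c' i - t₀ i) := by
          simp only [hk, cellReflect_apply, Function.update_self]
          have : ((2 ^ (j + 1) - 1 : ℕ) : ZMod N) = 2 * ((2 ^ j : ℕ) : ZMod N) - 1 := by
            rw [Nat.cast_sub Nat.one_le_two_pow, pow_succ]; push_cast; ring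
          rw [this]; ring
        rw [hval, zmod_val_natCast_sub (by omega) (by omega)]
        omega
  · intro hc
    rcases mem_axisRun_succ hj hc with h | h
    · exact Or.inl h
    · exact Or.inr ⟨_, h, cellReflect_cellReflect i k c⟩

variable {ψ : Finset (BlockIdx d N) → ℝ}

/-- **One doubling step for the set function**: if `ψ ≥ 0`, `ψ ∅ ≤ 1` and `ψ` satisfies the reflection
Cauchy–Schwarz inequalities, then `ψ(run of 2^j)² ≤ ψ(run of 2^(j+1))` (`2^(j+1) ≤ N`), because the
complementary symmetrisation is empty. [cite: FriedliVelenik2017, Theorem 10.11 (proof)] -/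
theorem sq_le_axisRun_succ (h0 : ∀ S, 0 ≤ ψ S) (hempty : ψ ∅ ≤ 1)
    (hcs : ∀ (i : Fin d) (k : ZMod N) (S : Finset (BlockIdx d N)),
      ψ S ^ 2 ≤ ψ (symP i k S) * ψ (symM i k S))
    {j : ℕ} (hj : 2 ^ (j + 1) ≤ N) (t₀ : BlockIdx d N) (i : Fin d) :
    ψ (axisRun t₀ i j) ^ 2 ≤ ψ (axisRun t₀ i (j + 1)) := by
  have h := hcs i (t₀ i + ((2 ^ j : ℕ) : ZMod N)) (axisRun t₀ i j)
  rw [symP_axisRun_eq_empty hj, symM_axisRun hj] at h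
  calc ψ (axisRun t₀ i j) ^ 2 ≤ ψ ∅ * ψ (axisRun t₀ i (j + 1)) := h
    _ ≤ 1 * ψ (axisRun t₀ i (j + 1)) := mul_le_mul_of_nonneg_right hempty (h0 _)
    _ = ψ (axisRun t₀ i (j + 1)) := one_mul _

/-- **Growing along one axis** (`N = 2^(n+1)`, `n+1` doublings): `ψ(boxRun t₀ i)^N ≤ ψ(boxRun t₀ (i+1))`.
[cite: FriedliVelenik2017, Theorem 10.11 (proof)] -/
theorem pow_le_boxRun_succ {n : ℕ} (hNn : N = 2 ^ (n + 1)) (h0 : ∀ S, 0 ≤ ψ S) (hempty : ψ ∅ ≤ 1)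
    (hcs : ∀ (i : Fin d) (k : ZMod N) (S : Finset (BlockIdx d N)),
      ψ S ^ 2 ≤ ψ (symP i k S) * ψ (symM i k S))
    (t₀ : BlockIdx d N) (i : Fin d) :
    ψ (boxRun t₀ i.val) ^ N ≤ ψ (boxRun t₀ (i.val + 1)) := by
  have key : ∀ j : ℕ, j ≤ n + 1 → ψ (axisRun t₀ i 0) ^ (2 ^ j) ≤ ψ (axisRun t₀ i j) := by
    intro j
    induction j with
    | zero => intro; simp
    | succ j ih =>
      intro hj
      have h2 : 2 ^ (j + 1) ≤ N := by
        rw [hNn]; exact Nat.pow_le_pow_right (by norm_num) hj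
      calc ψ (axisRun t₀ i 0) ^ 2 ^ (j + 1) = (ψ (axisRun t₀ i 0) ^ 2 ^ j) ^ 2 := by
            rw [pow_succ, pow_mul]
        _ ≤ ψ (axisRun t₀ i j) ^ 2 :=
            pow_le_pow_left₀ (pow_nonneg (h0 _) _) (ih (Nat.le_of_succ_le hj)) 2
        _ ≤ ψ (axisRun t₀ i (j + 1)) := sq_le_axisRun_succ h0 hempty hcs h2 t₀ i
  have h := key (n + 1) le_rfl
  rw [← hNn, axisRun_zero, axisRun_of_le hNn.le] at h
  exact h

/-- **Growing over all axes**: `ψ({t₀})^(N^d) ≤ ψ(univ)` for `N = 2^(n+1)` — the chessboard estimate for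
one cell in power form, with no positivity assumption on `ψ(univ)`.
[cite: FriedliVelenik2017, Theorem 10.11] -/
theorem singleton_pow_le_univ {n : ℕ} (hNn : N = 2 ^ (n + 1)) (h0 : ∀ S, 0 ≤ ψ S) (hempty : ψ ∅ ≤ 1)
    (hcs : ∀ (i : Fin d) (k : ZMod N) (S : Finset (BlockIdx d N)),
      ψ S ^ 2 ≤ ψ (symP i k S) * ψ (symM i k S))
    (t₀ : BlockIdx d N) : ψ {t₀} ^ (N ^ d) ≤ ψ univ := by
  have key : ∀ m : ℕ, m ≤ d → ψ (boxRun t₀ 0) ^ (N ^ m) ≤ ψ (boxRun t₀ m) := by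
    intro m
    induction m with
    | zero => intro; simp
    | succ m ih =>
      intro hm
      calc ψ (boxRun t₀ 0) ^ N ^ (m + 1) = (ψ (boxRun t₀ 0) ^ N ^ m) ^ N := by rw [pow_succ, pow_mul]
        _ ≤ ψ (boxRun t₀ m) ^ N :=
            pow_le_pow_left₀ (pow_nonneg (h0 _) _) (ih (Nat.le_of_succ_le hm)) N
        _ ≤ ψ (boxRun t₀ (m + 1)) := pow_le_boxRun_succ hNn h0 hempty hcs t₀ ⟨m, hm⟩
  have h := key d le_rfl
  rw [boxRun_zero, boxRun_eq_univ] at h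
  exact h

/-- **The chessboard estimate for one cell** (Fröhlich–Israel–Lieb–Simon 1978; Friedli–Velenik Theorem
10.11, one non-trivial factor): `ψ({t₀}) ≤ ψ(univ)^{1/N^d}` for `N = 2^(n+1)`, from `ψ ≥ 0`, `ψ ∅ ≤ 1`
and reflection Cauchy–Schwarz alone. [cite: FriedliVelenik2017, Theorem 10.11] -/
theorem singleton_le_univ_rpow {n : ℕ} (hNn : N = 2 ^ (n + 1)) (h0 : ∀ S, 0 ≤ ψ S) (hempty : ψ ∅ ≤ 1)
    (hcs : ∀ (i : Fin d) (k : ZMod N) (S : Finset (BlockIdx d N)),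
      ψ S ^ 2 ≤ ψ (symP i k S) * ψ (symM i k S))
    (t₀ : BlockIdx d N) : ψ {t₀} ≤ ψ univ ^ ((1 : ℝ) / (N : ℝ) ^ d) := by
  have hNd : (0 : ℝ) < (N : ℝ) ^ d := by
    have : (0 : ℝ) < N := by exact_mod_cast Nat.pos_of_ne_zero (NeZero.ne N)
    positivity
  have h := singleton_pow_le_univ hNn h0 hempty hcs t₀
  have hroot : ψ {t₀} = (ψ {t₀} ^ (N ^ d)) ^ ((1 : ℝ) / (N : ℝ) ^ d) := by
    rw [← Real.rpow_natCast, ← Real.rpow_mul (h0 _)]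
    push_cast
    rw [mul_one_div_cancel hNd.ne', Real.rpow_one]
  rw [hroot]
  exact Real.rpow_le_rpow (pow_nonneg (h0 _) _) h (by positivity)

end Doubling

section WilsonState

open Literature.MathematicalPhysics.QuantumFieldTheory

variable {d L N : ℕ} {G : Type*} [Group G] [TopologicalSpace G] [IsTopologicalGroup G] [CompactSpace G]
  [MeasurableSpace G] [BorelSpace G] (ρ : G →* Matrix (Fin N) (Fin N) ℂ)

/-- The torus Wilson state `Z⁻¹ • (e^{-βS} dHaar)` has total mass `Z⁻¹ Z ≤ 1` (it is `1` for continuous `ρ`;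
the inequality holds unconditionally, also for the junk values `Z = 0, ∞`). [folklore] -/
theorem wilsonMeasure_univ_le_one [NeZero L] (β : ℝ) :
    wilsonMeasure (d := d) (L := L) ρ β Set.univ ≤ 1 := by
  rw [wilsonMeasure, Measure.smul_apply, smul_eq_mul]
  exact ENNReal.inv_mul_le_one _

/-- The Wilson expectation of the constant `1` is at most `1`. [folklore] -/
theorem wilsonExpectation_one_le_one [NeZero L] (β : ℝ) :
    wilsonExpectation (d := d) (L := L) ρ β (fun _ => (1 : ℝ)) ≤ 1 := by
  rw [wilsonExpectation, integral_const, smul_eq_mul, mul_one, measureReal_def]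
  calc (wilsonMeasure (d := d) (L := L) ρ β Set.univ).toReal ≤ (1 : ℝ≥0∞).toReal :=
        ENNReal.toReal_mono ENNReal.one_ne_top (wilsonMeasure_univ_le_one ρ β)
    _ = 1 := ENNReal.toReal_one

end WilsonState

end Summit.QuantumFields.YangMills.Theorems.FemtoCurvatureTwoPoint.ChessboardOfRPCS

namespace Summit.QuantumFields.YangMills.Theorems.FemtoCurvatureTwoPoint

open Literature.MathematicalPhysics.QuantumFieldTheory
open Literature.Barriers.CriticalPhenomena.NonGibbs (symP symM)

/-- **Stub CHESS-of-RPCS — chessboard estimate for the `01`-plaquette field on dyadic tori** (line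
`generic-step-gamma-encoding` of crux `FemtoCurvatureTwoPoint`, registered signature verbatim). If the
products `ψ(S) = E_β[∏_{x∈S} f(N − Re tr ρ(U_{(x;01)}))]` of a bounded measurable `f ≥ 0` of the
`01`-plaquette field satisfy the reflection Cauchy–Schwarz inequalities
`ψ(S)² ≤ ψ(symP i k S) ψ(symM i k S)` on every even torus (hypothesis; the statement of
`stub_plaquetteProductRPCS`), then on the dyadic tori `L = 2^(n+1)`:
`E_β[f(P_0)] ≤ (E_β[∏_x f(P_x)])^{1/L⁴}` (Fröhlich–Israel–Lieb–Simon 1978; Friedli–Velenik 2017,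
Theorem 10.11). Proof: iterated doubling of runs from `{0}`, the complementary symmetrisation being
empty at each step (`ChessboardOfRPCS.singleton_le_univ_rpow`). [cite: FriedliVelenik2017, Theorem 10.11] -/
theorem stub_chessboard_of_RPCS :
    (∀ (G : Type) [Group G] [TopologicalSpace G] [IsTopologicalGroup G] [CompactSpace G]
          [MeasurableSpace G] [BorelSpace G] (N : ℕ) (ρ : G →* Matrix (Fin N) (Fin N) ℂ),
        Continuous ρ → (∀ g, ρ g ∈ Matrix.unitaryGroup (Fin N) ℂ) →
        ∀ (L : ℕ) [NeZero L], Even L → ∀ (β : ℝ), 0 ≤ β →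
        ∀ (f : ℝ → ℝ), Measurable f → (∀ t, 0 ≤ f t) → (∃ M : ℝ, ∀ t, f t ≤ M) →
        ∀ (ψ : Finset (Fin 4 → ZMod L) → ℝ),
          (ψ = fun S => wilsonExpectation (d := 4) (L := L) ρ β
            (fun U => ∏ x ∈ S, f ((N : ℝ) - (ρ (plaquetteHolonomy U x 0 1)).trace.re))) →
          ∀ (i : Fin 4) (k : ZMod L) (S : Finset (Fin 4 → ZMod L)),
            ψ S ^ 2 ≤ ψ (symP i k S) * ψ (symM i k S)) →
    ∀ (G : Type) [Group G] [TopologicalSpace G] [IsTopologicalGroup G] [CompactSpace G]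
        [MeasurableSpace G] [BorelSpace G] (N : ℕ) (ρ : G →* Matrix (Fin N) (Fin N) ℂ),
      Continuous ρ → (∀ g, ρ g ∈ Matrix.unitaryGroup (Fin N) ℂ) →
      ∀ (n L : ℕ) [NeZero L], L = 2 ^ (n + 1) → ∀ (β : ℝ), 0 ≤ β →
      ∀ (f : ℝ → ℝ), Measurable f → (∀ t, 0 ≤ f t) → (∃ M : ℝ, ∀ t, f t ≤ M) →
        wilsonExpectation (d := 4) (L := L) ρ β
            (fun U => f ((N : ℝ) - (ρ (plaquetteHolonomy U 0 0 1)).trace.re)) ≤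
          (wilsonExpectation (d := 4) (L := L) ρ β
            (fun U => ∏ x : Fin 4 → ZMod L, f ((N : ℝ) - (ρ (plaquetteHolonomy U x 0 1)).trace.re)))
            ^ ((1 : ℝ) / (L : ℝ) ^ 4) := by
  intro hRP G _ _ _ _ _ _ N ρ hρc hρu n L _ hL β hβ f hfm hf0 hfb
  -- the set function `ψ(S) = E[∏_{x ∈ S} f(P_x)]`
  set ψ : Finset (Fin 4 → ZMod L) → ℝ := fun S => wilsonExpectation (d := 4) (L := L) ρ β
      (fun U => ∏ x ∈ S, f ((N : ℝ) - (ρ (plaquetteHolonomy U x 0 1)).trace.re)) with hψ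
  have hL2 : Even L := hL ▸ Nat.even_pow.2 ⟨even_two, Nat.succ_ne_zero n⟩
  -- reflection Cauchy–Schwarz (hypothesis RPCS)
  have hcs : ∀ (i : Fin 4) (k : ZMod L) (S : Finset (Fin 4 → ZMod L)),
      ψ S ^ 2 ≤ ψ (symP i k S) * ψ (symM i k S) :=
    hRP G N ρ hρc hρu L hL2 β hβ f hfm hf0 hfb ψ hψ
  -- `ψ ≥ 0` and `ψ ∅ ≤ 1`
  have h0 : ∀ S, 0 ≤ ψ S := fun S => by
    simp only [hψ, wilsonExpectation]
    exact integral_nonneg fun U => Finset.prod_nonneg fun x _ => hf0 _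
  have hempty : ψ ∅ ≤ 1 := by
    simp only [hψ, Finset.prod_empty]
    exact ChessboardOfRPCS.wilsonExpectation_one_le_one (d := 4) (L := L) ρ β
  -- iterated doubling from the cell `0`
  have key := ChessboardOfRPCS.singleton_le_univ_rpow (d := 4) (N := L) (ψ := ψ) hL h0 hempty hcs 0
  have e0 : ψ {0} = wilsonExpectation (d := 4) (L := L) ρ β
      (fun U => f ((N : ℝ) - (ρ (plaquetteHolonomy U 0 0 1)).trace.re)) := by
    simp only [hψ, Finset.prod_singleton]
  rw [← e0]
  exact key

end Summit.QuantumFields.YangMills.Theorems.FemtoCurvatureTwoPoint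

end
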